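import Mathlib
import HarnessLib
import Literature.Analysis.FluidPDE.MildAncientTimeDecayRegularity
import Literature.Analysis.FluidPDE.TaoEnstrophyLocalisation
import Summits.NavierStokesRegularity.NavierStokesRegularity.Theorems.PoloidalWindowDoorLrcModEntireRidgeHullTools
import Summits.NavierStokesRegularity.NavierStokesRegularity.Theorems.PoloidalWindowDoorLrcModEntireRidgeClassConstants

/-!
# Item `LrcModEntire` (stmt-NavierStokesRegularity-20428) — the GLOBAL (TH) IDENTITY, the SLOPE FORM `∂_z vₕ = μ∇ₕθ` and the FROZEN LAW are CLOSED UNDER HULL LIMITS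

ns-k2-port-2 g6 (helper prover under the LEAD of item 20428, ns-poloidal-K2-p3 g15; `--supports stmt-NavierStokesRegularity-20428 --as helper`).
Memo `Cruxes/LrcModEntire/T2B-g14.md` §6 (R-i) / §10 (Q3) asserts «(TH) with its slope function `μ` is invariant under horizontal translation and closed under hull
limits»; the hull machinery (`…HotHullCompactness.hullLimit`, port-2's `…RidgeHull` / `…RidgeHullValues` / `…RidgeWebClass`) exports the limit `U` of the re-pinned
translates `x ↦ v(t, x + y_j)` (slices converging locally uniformly) with the pinned class package and Peakless, but NOT the (TH) data.  This file supplies the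
missing closure statements BY NAME, at a fixed time `t < 0`, from the class clauses of `v` alone:

* `contDiff_and_tendsto_iteratedFDeriv_translate` — all jets of the translates converge locally uniformly to those of the (smooth) limit slice ((F1) bounds at the
  slice, `exists_norm_iteratedFDeriv_le_slice_of_hasTypeITimeDecay`, are translation invariant; `…RidgeHullTools` T0);
* `tendsto_fderiv_translate_apply` — `D(v t)(x_j + y_j)[m_j] → D(U t)(x₀)[m₀]` along converging base points and directions (T2, order one);
* `TH_of_hullLimit` — the GLOBAL bilinear (TH) identity `∂₂v_b(t,x)·∂_c v₂(t,x′) = ∂₂v_c(t,x′)·∂_b v₂(t,x)` (`x₂ = x′₂`, `b, c ≠ 2`; the `hTH` clause of `stub_T2b`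
  VERBATIM at time `t`) passes to the limit slice;
* `slopeForm_of_hullLimit` — for translation points IN THE THREAD PLANE (`(y_j)₂ = 0`, hot points) the slope form `∂₂v_b(t,x) = μ(x₂)·∂_b v₂(t,x)` passes to the
  limit WITH THE SAME slope function `μ`;
* `slopeForm_of_hullLimit_slab` — the same for a slope form given only on the slab of heights `x₂ ∈ S` (what the (TH) column supplies near the thread plane);
* `frozenLaw_of_hullLimit` — the frozen law `⟪∇v(t,x)·ω(t,x), e₂⟫ = 0` (the `stub_T2b` clause) passes to the limit (`curl = curlCLM ∘ fderiv`).

WHAT THIS IS NOT: not a claim about Navier–Stokes regularity — bookkeeping making the hull element of the (Q3∞)/(Q4) entrance «again a (TH) profile with the same μ»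
by name (bears_on LADDER-NS N0, item 20428 / crux 19708; 20428/19708/27893 OPEN; (Q4) OPEN).  No summit statement is proved here.
-/

noncomputable section

-- the summit and its single sub-problem share the name (CONVENTIONS §1), as in every Theorems file
set_option linter.dupNamespace false

namespace Summit.NavierStokesRegularity.NavierStokesRegularity.Theorems.PoloidalWindowDoorLrcModEntireRidgeHullTH

open Set Filter Topology Metric Function
open scoped ContDiff InnerProductSpace RealInnerProductSpace
open Literature.Analysis Literature.Analysis.FluidPDE
open Summit.NavierStokesRegularity.NavierStokesRegularity.Theorems.PoloidalWindowDoorLrcModEntireRidgeHullTools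
open Summit.NavierStokesRegularity.NavierStokesRegularity.Theorems.PoloidalWindowDoorLrcModEntireRidgeClassConstants

variable {C : ℝ} {v : ℝ → EuclideanSpace ℝ (Fin 3) → EuclideanSpace ℝ (Fin 3)}

/-- **All jets of the translates converge to those of the limit slice.**  Class clauses of `v`, `t < 0`, translation points `y_j`, and
`x ↦ v(t, x + y_j) → U_t` locally uniformly ⇒ `U_t ∈ C^∞` and `Dⁱ(v(t, · + y_j)) → Dⁱ U_t` locally uniformly for every `i`. -/
theorem contDiff_and_tendsto_iteratedFDeriv_translate (hrate : HasTypeITimeDecay C v) (hcont : ContinuousOn (uncurry v) (Iio (0 : ℝ) ×ˢ univ))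
    (hmild : ∀ s t : ℝ, s < t → t < 0 → ∀ x, v t x = UnboundedOperators.heatExtension (v s) (t - s) x - oseenDuhamel 1 s v v t x)
    (hdiv : ∀ t < 0, VectorCalculus.IsDivFree (v t)) {t : ℝ} (ht : t < 0) {y : ℕ → EuclideanSpace ℝ (Fin 3)}
    {Ut : EuclideanSpace ℝ (Fin 3) → EuclideanSpace ℝ (Fin 3)} (hconv : TendstoLocallyUniformly (fun j x => v t (x + y j)) Ut atTop) :
    ContDiff ℝ ∞ Ut ∧ ∀ i : ℕ, TendstoLocallyUniformlyOn (fun j => iteratedFDeriv ℝ i (fun x => v t (x + y j))) (iteratedFDeriv ℝ i Ut) atTop univ := by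
  have hslice : ContDiff ℝ ∞ (v t) := contDiff_slice_of_class hrate hcont hmild hdiv ht
  have hF1 : ∀ k : ℕ, ∃ K : ℝ, ∀ x, ‖iteratedFDeriv ℝ k (v t) x‖ ≤ K := fun k =>
    exists_norm_iteratedFDeriv_le_slice_of_hasTypeITimeDecay hrate hcont hmild (isWeaklyDivFree_of_class hrate hcont hmild hdiv) ht k
  have hfj_smooth : ∀ j, ContDiffOn ℝ ∞ (fun x => v t (x + y j)) univ := fun j =>
    (hslice.comp (contDiff_id.add contDiff_const)).contDiffOn
  have hfj_bd : ∀ (i : ℕ), ∀ K ⊆ (univ : Set (EuclideanSpace ℝ (Fin 3))), IsCompact K →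
      ∃ Λ : ℝ, ∀ n, ∀ z ∈ K, ‖iteratedFDeriv ℝ i (fun x => v t (x + y n)) z‖ ≤ Λ := by
    intro i K _ _
    obtain ⟨Λ, hΛ⟩ := hF1 i
    exact ⟨Λ, fun n z _ => by rw [iteratedFDeriv_comp_add_right]; exact hΛ _⟩
  obtain ⟨hU, hjets⟩ := contDiffOn_and_tendsto_iteratedFDeriv_of_tendstoLocallyUniformlyOn isOpen_univ hfj_smooth hfj_bd
    (tendstoLocallyUniformlyOn_univ.2 hconv)
  exact ⟨contDiffOn_univ.1 hU, hjets⟩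

/-- **First derivatives pass to the limit along converging base points and directions**: `D(v t)(x_j + y_j)[m_j] → D(U_t)(x₀)[m₀]`. -/
theorem tendsto_fderiv_translate_apply (hrate : HasTypeITimeDecay C v) (hcont : ContinuousOn (uncurry v) (Iio (0 : ℝ) ×ˢ univ))
    (hmild : ∀ s t : ℝ, s < t → t < 0 → ∀ x, v t x = UnboundedOperators.heatExtension (v s) (t - s) x - oseenDuhamel 1 s v v t x)
    (hdiv : ∀ t < 0, VectorCalculus.IsDivFree (v t)) {t : ℝ} (ht : t < 0) {y : ℕ → EuclideanSpace ℝ (Fin 3)}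
    {Ut : EuclideanSpace ℝ (Fin 3) → EuclideanSpace ℝ (Fin 3)} (hconv : TendstoLocallyUniformly (fun j x => v t (x + y j)) Ut atTop)
    {x : ℕ → EuclideanSpace ℝ (Fin 3)} {x₀ : EuclideanSpace ℝ (Fin 3)} (hx : Tendsto x atTop (𝓝 x₀))
    {m : ℕ → EuclideanSpace ℝ (Fin 3)} {m₀ : EuclideanSpace ℝ (Fin 3)} (hm : Tendsto m atTop (𝓝 m₀)) :
    Tendsto (fun j => fderiv ℝ (v t) (x j + y j) (m j)) atTop (𝓝 (fderiv ℝ Ut x₀ m₀)) := by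
  obtain ⟨hU, hjets⟩ := contDiff_and_tendsto_iteratedFDeriv_translate hrate hcont hmild hdiv ht hconv
  have hcontU : ContinuousOn (iteratedFDeriv ℝ 1 Ut) univ := (hU.continuous_iteratedFDeriv (by exact_mod_cast le_top)).continuousOn
  have hm' : Tendsto (fun j => (![m j] : Fin 1 → EuclideanSpace ℝ (Fin 3))) atTop (𝓝 ![m₀]) := by
    rw [tendsto_pi_nhds]; intro i; fin_cases i; simpa using hm
  have h := tendsto_iteratedFDeriv_apply isOpen_univ (hjets 1) hcontU (mem_univ x₀) hx hm'
  have e : ∀ j, iteratedFDeriv ℝ 1 (fun x => v t (x + y j)) (x j) ![m j] = fderiv ℝ (v t) (x j + y j) (m j) := fun j => by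
    rw [iteratedFDeriv_comp_add_right, iteratedFDeriv_one_apply]; rfl
  simp only [e] at h
  rw [iteratedFDeriv_one_apply] at h
  simpa using h

/-- **THE GLOBAL BILINEAR (TH) IDENTITY IS CLOSED UNDER HULL LIMITS** (the `hTH` clause of `stub_T2b`, one time `t < 0`): if
`∂₂v_b(t,x)·∂_c v₂(t,x′) = ∂₂v_c(t,x′)·∂_b v₂(t,x)` for all `x₂ = x′₂`, `b, c ≠ 2`, and `v(t, · + y_j) → U_t` locally uniformly, then `U_t` satisfies the same identity
(translation by a common `y_j` preserves `x₂ = x′₂`; products of first derivatives pass to the limit). -/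
theorem TH_of_hullLimit (hrate : HasTypeITimeDecay C v) (hcont : ContinuousOn (uncurry v) (Iio (0 : ℝ) ×ˢ univ))
    (hmild : ∀ s t : ℝ, s < t → t < 0 → ∀ x, v t x = UnboundedOperators.heatExtension (v s) (t - s) x - oseenDuhamel 1 s v v t x)
    (hdiv : ∀ t < 0, VectorCalculus.IsDivFree (v t)) {t : ℝ} (ht : t < 0)
    (hTH : ∀ x x' : EuclideanSpace ℝ (Fin 3), x 2 = x' 2 → ∀ b c : Fin 3, b ≠ 2 → c ≠ 2 →
      fderiv ℝ (v t) x (EuclideanSpace.single 2 1) b * fderiv ℝ (v t) x' (EuclideanSpace.single c 1) 2 =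
        fderiv ℝ (v t) x' (EuclideanSpace.single 2 1) c * fderiv ℝ (v t) x (EuclideanSpace.single b 1) 2)
    {y : ℕ → EuclideanSpace ℝ (Fin 3)} {Ut : EuclideanSpace ℝ (Fin 3) → EuclideanSpace ℝ (Fin 3)}
    (hconv : TendstoLocallyUniformly (fun j x => v t (x + y j)) Ut atTop) :
    ∀ x x' : EuclideanSpace ℝ (Fin 3), x 2 = x' 2 → ∀ b c : Fin 3, b ≠ 2 → c ≠ 2 →
      fderiv ℝ Ut x (EuclideanSpace.single 2 1) b * fderiv ℝ Ut x' (EuclideanSpace.single c 1) 2 =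
        fderiv ℝ Ut x' (EuclideanSpace.single 2 1) c * fderiv ℝ Ut x (EuclideanSpace.single b 1) 2 := by
  intro x x' hxx' b c hb hc
  -- the four first derivatives as limits
  have hD : ∀ (z w : EuclideanSpace ℝ (Fin 3)) (i : Fin 3),
      Tendsto (fun j => fderiv ℝ (v t) (z + y j) w i) atTop (𝓝 (fderiv ℝ Ut z w i)) := fun z w i =>
    ((EuclideanSpace.proj (𝕜 := ℝ) i).continuous.tendsto _).comp
      (tendsto_fderiv_translate_apply hrate hcont hmild hdiv ht hconv (x := fun _ => z) tendsto_const_nhds (m := fun _ => w) tendsto_const_nhds)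
  have hlim := ((hD x (EuclideanSpace.single 2 1) b).mul (hD x' (EuclideanSpace.single c 1) 2))
  have hlim' := ((hD x' (EuclideanSpace.single 2 1) c).mul (hD x (EuclideanSpace.single b 1) 2))
  have heq : ∀ j, fderiv ℝ (v t) (x + y j) (EuclideanSpace.single 2 1) b * fderiv ℝ (v t) (x' + y j) (EuclideanSpace.single c 1) 2 =
      fderiv ℝ (v t) (x' + y j) (EuclideanSpace.single 2 1) c * fderiv ℝ (v t) (x + y j) (EuclideanSpace.single b 1) 2 := fun j =>
    hTH (x + y j) (x' + y j) (by simp [hxx']) b c hb hc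
  exact tendsto_nhds_unique (hlim.congr heq) hlim'

/-- **THE SLOPE FORM WITH THE SAME SLOPE FUNCTION IS CLOSED UNDER HULL LIMITS ALONG THE THREAD PLANE**: if `∂₂v_b(t,x) = μ(x₂)·∂_b v₂(t,x)` for all `x` and
`b ≠ 2` (slope function of the height only, at the fixed time `t`), the translation points lie in the thread plane (`(y_j)₂ = 0`, e.g. hot points) and
`v(t, · + y_j) → U_t` locally uniformly, then `∂₂(U_t)_b(x) = μ(x₂)·∂_b (U_t)₂(x)` for all `x`, `b ≠ 2` — the SAME `μ`. -/
theorem slopeForm_of_hullLimit (hrate : HasTypeITimeDecay C v) (hcont : ContinuousOn (uncurry v) (Iio (0 : ℝ) ×ˢ univ))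
    (hmild : ∀ s t : ℝ, s < t → t < 0 → ∀ x, v t x = UnboundedOperators.heatExtension (v s) (t - s) x - oseenDuhamel 1 s v v t x)
    (hdiv : ∀ t < 0, VectorCalculus.IsDivFree (v t)) {t : ℝ} (ht : t < 0) {μ : ℝ → ℝ}
    (hslope : ∀ x : EuclideanSpace ℝ (Fin 3), ∀ b : Fin 3, b ≠ 2 →
      fderiv ℝ (v t) x (EuclideanSpace.single 2 1) b = μ (x 2) * fderiv ℝ (v t) x (EuclideanSpace.single b 1) 2)
    {y : ℕ → EuclideanSpace ℝ (Fin 3)} (hy : ∀ j, y j 2 = 0) {Ut : EuclideanSpace ℝ (Fin 3) → EuclideanSpace ℝ (Fin 3)}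
    (hconv : TendstoLocallyUniformly (fun j x => v t (x + y j)) Ut atTop) :
    ∀ x : EuclideanSpace ℝ (Fin 3), ∀ b : Fin 3, b ≠ 2 →
      fderiv ℝ Ut x (EuclideanSpace.single 2 1) b = μ (x 2) * fderiv ℝ Ut x (EuclideanSpace.single b 1) 2 := by
  intro x b hb
  have hD : ∀ (w : EuclideanSpace ℝ (Fin 3)) (i : Fin 3),
      Tendsto (fun j => fderiv ℝ (v t) (x + y j) w i) atTop (𝓝 (fderiv ℝ Ut x w i)) := fun w i =>
    ((EuclideanSpace.proj (𝕜 := ℝ) i).continuous.tendsto _).comp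
      (tendsto_fderiv_translate_apply hrate hcont hmild hdiv ht hconv (x := fun _ => x) tendsto_const_nhds (m := fun _ => w) tendsto_const_nhds)
  have heq : ∀ j, fderiv ℝ (v t) (x + y j) (EuclideanSpace.single 2 1) b = μ (x 2) * fderiv ℝ (v t) (x + y j) (EuclideanSpace.single b 1) 2 := fun j => by
    have h := hslope (x + y j) b hb
    have hx2 : (x + y j) 2 = x 2 := by simp [hy j]
    rwa [hx2] at h
  have h1 : Tendsto (fun j => fderiv ℝ (v t) (x + y j) (EuclideanSpace.single 2 1) b) atTop (𝓝 (fderiv ℝ Ut x (EuclideanSpace.single 2 1) b)) :=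
    hD (EuclideanSpace.single 2 1) b
  have h2 : Tendsto (fun j => fderiv ℝ (v t) (x + y j) (EuclideanSpace.single 2 1) b) atTop (𝓝 (μ (x 2) * fderiv ℝ Ut x (EuclideanSpace.single b 1) 2)) :=
    ((hD (EuclideanSpace.single b 1) 2).const_mul (μ (x 2))).congr fun j => (heq j).symm
  exact tendsto_nhds_unique h1 h2

/-- **THE FROZEN LAW IS CLOSED UNDER HULL LIMITS** (the `stub_T2b` clause `⟪∇v(t,x)·ω(t,x), e₂⟫ = 0`, one time `t < 0`): the vorticity of the translates converges with
the first derivatives (`curl = curlCLM ∘ fderiv`), so `⟪D(U_t)(x)[curl U_t (x)], e₂⟫ = 0`. -/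
theorem frozenLaw_of_hullLimit (hrate : HasTypeITimeDecay C v) (hcont : ContinuousOn (uncurry v) (Iio (0 : ℝ) ×ˢ univ))
    (hmild : ∀ s t : ℝ, s < t → t < 0 → ∀ x, v t x = UnboundedOperators.heatExtension (v s) (t - s) x - oseenDuhamel 1 s v v t x)
    (hdiv : ∀ t < 0, VectorCalculus.IsDivFree (v t)) {t : ℝ} (ht : t < 0)
    (hfrozen : ∀ x : EuclideanSpace ℝ (Fin 3), ⟪fderiv ℝ (v t) x (curl (v t) x), EuclideanSpace.single 2 1⟫_ℝ = 0)
    {y : ℕ → EuclideanSpace ℝ (Fin 3)} {Ut : EuclideanSpace ℝ (Fin 3) → EuclideanSpace ℝ (Fin 3)}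
    (hconv : TendstoLocallyUniformly (fun j x => v t (x + y j)) Ut atTop) :
    ∀ x : EuclideanSpace ℝ (Fin 3), ⟪fderiv ℝ Ut x (curl Ut x), EuclideanSpace.single 2 1⟫_ℝ = 0 := by
  intro x
  -- the vorticity of the translates at `x + y_j` converges to `curl U_t x`
  have hcurl : Tendsto (fun j => curl (v t) (x + y j)) atTop (𝓝 (curl Ut x)) := by
    have h : ∀ w : EuclideanSpace ℝ (Fin 3), Tendsto (fun j => fderiv ℝ (v t) (x + y j) w) atTop (𝓝 (fderiv ℝ Ut x w)) := fun w =>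
      tendsto_fderiv_translate_apply hrate hcont hmild hdiv ht hconv (x := fun _ => x) tendsto_const_nhds (m := fun _ => w) tendsto_const_nhds
    have hop : Tendsto (fun j => fderiv ℝ (v t) (x + y j)) atTop (𝓝 (fderiv ℝ Ut x)) := by
      obtain ⟨hU, hjets⟩ := contDiff_and_tendsto_iteratedFDeriv_translate hrate hcont hmild hdiv ht hconv
      have hcontU : ContinuousOn (iteratedFDeriv ℝ 1 Ut) univ := (hU.continuous_iteratedFDeriv (by exact_mod_cast le_top)).continuousOn
      have h1 : Tendsto (fun j => iteratedFDeriv ℝ 1 (fun z => v t (z + y j)) x) atTop (𝓝 (iteratedFDeriv ℝ 1 Ut x)) :=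
        (hjets 1).tendsto_comp (hcontU.continuousWithinAt (mem_univ x)) (mem_univ x)
          (tendsto_nhdsWithin_of_tendsto_nhds_of_eventually_within _ tendsto_const_nhds (Eventually.of_forall fun _ => mem_univ _))
      -- un-curry the order-one jets through the (continuous, linear) `continuousMultilinearCurryFin1`
      have e : ∀ g : EuclideanSpace ℝ (Fin 3) → EuclideanSpace ℝ (Fin 3), ∀ z,
          fderiv ℝ g z = (continuousMultilinearCurryFin1 ℝ (EuclideanSpace ℝ (Fin 3)) (EuclideanSpace ℝ (Fin 3))) (iteratedFDeriv ℝ 1 g z) := fun g z => by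
        ext w; simp [iteratedFDeriv_one_apply]
      have h2 := ((continuousMultilinearCurryFin1 ℝ (EuclideanSpace ℝ (Fin 3)) (EuclideanSpace ℝ (Fin 3))).continuous.tendsto _).comp h1
      rw [e Ut x]
      refine h2.congr fun j => ?_
      rw [Function.comp_apply, ← e, fderiv_comp_add_right]
    simp only [curl_eq_curlCLM]
    exact (curlCLM.continuous.tendsto _).comp hop
  have hpair := tendsto_fderiv_translate_apply hrate hcont hmild hdiv ht hconv (x := fun _ => x) tendsto_const_nhds hcurl
  have hinner : Tendsto (fun j => ⟪fderiv ℝ (v t) (x + y j) (curl (v t) (x + y j)), EuclideanSpace.single 2 1⟫_ℝ) atTop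
      (𝓝 ⟪fderiv ℝ Ut x (curl Ut x), EuclideanSpace.single 2 1⟫_ℝ) := hpair.inner tendsto_const_nhds
  have e0 : (fun j => ⟪fderiv ℝ (v t) (x + y j) (curl (v t) (x + y j)), EuclideanSpace.single 2 1⟫_ℝ) = fun _ => (0 : ℝ) := funext fun j => hfrozen _
  rw [e0] at hinner
  exact tendsto_nhds_unique hinner tendsto_const_nhds

/-- **THE SLOPE FORM ON A SLAB IS CLOSED UNDER HULL LIMITS ALONG THE THREAD PLANE** (the form the (TH) column actually supplies: by
`…TwistingTHSlopeFunction.exists_slopeFunction_near_plane` the slope form holds on WHOLE PLANES of heights `x₂ ∈ S` near the thread plane, not on all of `ℝ³`): if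
`∂₂v_b(t,x) = μ(x₂)·∂_b v₂(t,x)` for all `x` with `x₂ ∈ S` and `b ≠ 2`, the translation points lie in the thread plane (`(y_j)₂ = 0`) and `v(t, · + y_j) → U_t` locally
uniformly, then `∂₂(U_t)_b(x) = μ(x₂)·∂_b (U_t)₂(x)` for all `x` with `x₂ ∈ S`, `b ≠ 2` — the SAME `μ` (answering refuter1 g21's K-317 interface note). -/
theorem slopeForm_of_hullLimit_slab (hrate : HasTypeITimeDecay C v) (hcont : ContinuousOn (uncurry v) (Iio (0 : ℝ) ×ˢ univ))
    (hmild : ∀ s t : ℝ, s < t → t < 0 → ∀ x, v t x = UnboundedOperators.heatExtension (v s) (t - s) x - oseenDuhamel 1 s v v t x)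
    (hdiv : ∀ t < 0, VectorCalculus.IsDivFree (v t)) {t : ℝ} (ht : t < 0) {μ : ℝ → ℝ} {S : Set ℝ}
    (hslope : ∀ x : EuclideanSpace ℝ (Fin 3), x 2 ∈ S → ∀ b : Fin 3, b ≠ 2 →
      fderiv ℝ (v t) x (EuclideanSpace.single 2 1) b = μ (x 2) * fderiv ℝ (v t) x (EuclideanSpace.single b 1) 2)
    {y : ℕ → EuclideanSpace ℝ (Fin 3)} (hy : ∀ j, y j 2 = 0) {Ut : EuclideanSpace ℝ (Fin 3) → EuclideanSpace ℝ (Fin 3)}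
    (hconv : TendstoLocallyUniformly (fun j x => v t (x + y j)) Ut atTop) :
    ∀ x : EuclideanSpace ℝ (Fin 3), x 2 ∈ S → ∀ b : Fin 3, b ≠ 2 →
      fderiv ℝ Ut x (EuclideanSpace.single 2 1) b = μ (x 2) * fderiv ℝ Ut x (EuclideanSpace.single b 1) 2 := by
  intro x hx b hb
  have hD : ∀ (w : EuclideanSpace ℝ (Fin 3)) (i : Fin 3),
      Tendsto (fun j => fderiv ℝ (v t) (x + y j) w i) atTop (𝓝 (fderiv ℝ Ut x w i)) := fun w i =>
    ((EuclideanSpace.proj (𝕜 := ℝ) i).continuous.tendsto _).comp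
      (tendsto_fderiv_translate_apply hrate hcont hmild hdiv ht hconv (x := fun _ => x) tendsto_const_nhds (m := fun _ => w) tendsto_const_nhds)
  have heq : ∀ j, fderiv ℝ (v t) (x + y j) (EuclideanSpace.single 2 1) b = μ (x 2) * fderiv ℝ (v t) (x + y j) (EuclideanSpace.single b 1) 2 := fun j => by
    have hx2 : (x + y j) 2 = x 2 := by simp [hy j]
    have h := hslope (x + y j) (by rw [hx2]; exact hx) b hb
    rwa [hx2] at h
  have h1 : Tendsto (fun j => fderiv ℝ (v t) (x + y j) (EuclideanSpace.single 2 1) b) atTop (𝓝 (fderiv ℝ Ut x (EuclideanSpace.single 2 1) b)) :=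
    hD (EuclideanSpace.single 2 1) b
  have h2 : Tendsto (fun j => fderiv ℝ (v t) (x + y j) (EuclideanSpace.single 2 1) b) atTop (𝓝 (μ (x 2) * fderiv ℝ Ut x (EuclideanSpace.single b 1) 2)) :=
    ((hD (EuclideanSpace.single b 1) 2).const_mul (μ (x 2))).congr fun j => (heq j).symm
  exact tendsto_nhds_unique h1 h2

end Summit.NavierStokesRegularity.NavierStokesRegularity.Theorems.PoloidalWindowDoorLrcModEntireRidgeHullTH

end
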